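import Literature.NumberTheory.LFunctions.ChainTableSieve
import HarnessLib

/-!
# Completeness of the prime table: walk piece 1 of 8
# (plan N1 of provefact `Literature.NumberTheory.LFunctions.robin_iff`)

Topic: `Literature/NumberTheory/LFunctions`. Pure proof file (one kernel computation; nothing is
asserted, no definition). The table `ChainTable.table` (`ChainTable.lean`, data
`ChainTableData0.lean` … `ChainTableData7.lean`: the `322441` primes below `4.6·10⁶`, of which only
completeness is ever used) is certified complete by the gap walk `ChainTable.walkH` of
`ChainTableSieve.lean` (`walkH_sound`: for odd `a`, `walkH fuel a seg = some L` implies that `seg`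
is strictly increasing with odd entries in `(a, L]`, `L` is its last entry, and every odd prime in
`(a, L]` is an entry — each skipped odd number being certified composite by one `gcd` with the
product of the odd primes `≤ 2143`). The `322440` entries of `table.tail` are walked in `8` pieces
of `40305` entries, `(table.tail.drop (40305·(i−1))).take 40305`, each started at the last entry of
the previous piece (piece 1 at `a = 1`), so that the pieces chain (`ChainTableFacts.walk_tail`:
`walkH _ 1 table.tail = some 4599989`, whence `ChainCheck.TableOK table 4599989`,
`ChainTableFacts.tableOK`). This file is piece 1: entries `0`–`40304` of `table.tail` (the primes
from `3` to `483829`), started at `a = 1`. `decide +kernel`, standard axioms only; the kernel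
decodes the table prefix lazily and performs one GMP `gcd` per odd composite of the range (about one
minute on the farm; `maxHeartbeats 0` lifts the deterministic time-out for this one declaration). It
also records that `table.tail` has no entry beyond position `322440` (`tail_drop_nil`, the end of
the chain of pieces).

## References

* (method) Eratosthenes; compositeness by gcd with a primorial, folklore.
* G. Robin, *Grandes valeurs de la fonction somme des diviseurs et hypothèse de Riemann*, J. Math.
  Pures Appl. 63 (1984), 187–213, §3 (the colossally abundant numbers are checked from tables of
  primes). [Robin1984]
-/

namespace Literature.NumberTheory.LFunctions.ChainTable

set_option maxHeartbeats 0 in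
/-- **Walk piece 1 of 8**: the gap walk over entries `0`–`40304` of `table.tail`, from `a = 1`,
succeeds and ends at the entry `483829`. [folklore] -/
theorem walk1 :
    walkH 40400 1 ((table.tail.drop 0).take 40305) = some 483829 := by
  decide +kernel

set_option maxHeartbeats 0 in
/-- `table.tail` is exhausted after `322440 = 8·40305` entries (kernel evaluation of the whole
decoded table). [folklore] -/
theorem tail_drop_nil : table.tail.drop 322440 = [] := by
  decide +kernel

end Literature.NumberTheory.LFunctions.ChainTable
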